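import Literature.MathematicalPhysics.QuantumFieldTheory.Balaban1983to89.Node00.TorusCoverLandau153TowerWindow
import Literature.MathematicalPhysics.QuantumFieldTheory.Balaban1983to89.Node00.TorusCoverLandau153Box

/-!
# NODE 00 — THE (152)+(153) DOOR ON THE WHOLE (1.131) TOWER `□₀` OF A `CubeB8` DATUM: this seat's tower push-down (`…TowerWindow`, FILE 3d′) at the windows `X := □₀`,
# `X_t := □` (the top box), `X′ := □̃` — the gauge equation `U^u = e^{iη_nA}` on every bond of `π(□₀)`, [15] (152)'s level-weighted letters on the bonds of `π(□_j)`, the four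
# top-box letters on `π(□)`, and the (153)-gauged lift on `□̃`; the step-closure of `□₀` from the collar `□₀ + 1 ⊆ □̃` ([6] p. 98) and the non-wrapping of `□̃` (displayed)

Cell `pub-ymgap`, width seat `pub-ymgap-dag-n07-w3` generation 7 (sub-target S3 = [15] (145)–(156) at objects; CLAIM-7 ∕ INTENT-7, cell INBOX 2026-08-28).  NEW leaf; CONSUMED BY
NAME, nothing modified: FILE 3d′ `Node00.TorusCoverLandau153TowerWindow` (`exists_localGauge152_tower_window_of_gaugedBoundB8`), generation 3's `Node00.TorusCoverLandau153Box` §1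
(`add_e_mem_box_of_shift_mem_image_of_injOn`, `sub_e_mem_box_of_unshift_mem_image_of_injOn`), `B8Eq131Cubes.collar_cube ∕ cube_subset_tcube`, `B8Eq131CubesAdmissible.cubeFam_false_zero`,
`Node00.TorusCoverLandau153TwoWindow`'s imports (`box_subset_sq_zero`, `cover_add_e`).  `--kind proof --supports stmt-QuantumFields-27364` (K1⁹; count-neutral helper).
[15] = [Balaban1985Variational]; [6] = [Balaban1985RegularSpaces]; [I] = [Balaban1987RG1].

WHY.  This is the TOWER DOOR of the S3 lane asked by dag-n07-w8 g6 (LOCATED-LANDAU-REGION) and dag-n07-w6 g3 (trigger (t3)): ONE `SU(N)` torus gauge `u` for the datum with the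
Landau copy `U^{u} = e^{iη_nA}` controlled on ALL of `π(□₀)` — letters `‖A‖ ≤ 2r·(Lʲη_n)⁻¹` on `π(□_j)`, i.e. print's (152) «`Lʲη|A| < 9dL²B₁Mε₀` on `Ω′_j`», height-uniform
(per-bond window `4·(N·r) < 2π`, FILES 3a′∕3b′∕3c′).  What stays DISPLAYED: [6] Prop. 6 at N05's member (`GaugedBoundB8`, the HYPOTHESIS) and the non-wrapping `Set.InjOn π □̃`
(numerics: `(M + 4ρ)·Lᵏ ≤ sitesPerDir 0`, k0-s1-w3's `K0S5CollarNumerics` pattern — not typed here).  The `dist1`-rows of the Landau copy's averages on the canonical boxes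
((3e′)) and the guarded ∕ box-form Summits twins at the print datum follow.

WHAT IS PROVED (kernel; no definition).  `sq_subset_sq_zero`, ★ `add_e_mem_sq_zero_of_shift_mem_image_of_injOn_tcube` (forward unit steps seen on the torus lift into `□₀`, from the collar `□₀ + 1 ⊆ □̃`
and the non-wrapping of `□̃`), ★★★ `exists_localGauge152_tower_of_gaugedBoundB8` (the seven clauses at `X := □₀`, `X_t := □`, `X′ := □̃`).
HONEST FRAMING: count-neutral push-down bookkeeping; `GaugedBoundB8` is the HYPOTHESIS (N05's node); the non-wrapping of `□̃` is DISPLAYED; NOTHING of [15]∕[6] analysis asserted;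
no token ∕ stub ∕ K-item closed; N07 ∕ N05 NOT discharged; counts unmoved; one finite 𝕋⁴ programme at fixed ε — R4 closes the conditional finite-𝕋⁴ rung `BalabanLadder.UV` only;
the YM mass gap (Clay) is NOT proved by any of this; nothing continuum ∕ ℝ⁴ ∕ OS.  No `sorry`, no `def`, no `instance`, no `notation`.

References: [Balaban1985Variational] (144)–(153) pp.300–301; [Balaban1985RegularSpaces] p.98 («□̃»), Prop. 6 (1.135)–(1.138) p.99, (1.131) p.99; [Balaban1987RG1] (0.1) p.251.
-/

noncomputable section

namespace Literature.MathematicalPhysics.QuantumFieldTheory.Balaban1983to89.Node00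

open scoped Matrix.Norms.L2Operator
open B7Prop1Explicit (e e_apply)
open B7Prop1Local (InBox)
open B8Eq131Cubes (box cube tcube tLo tHi bLo bHi)
open B8Eq138LandauZd (IsLandau138)
open B15Eq112TorusCover (cover)
open B14DomainGeom (Pt)
open B12RegularSpaces111 (gaugeU expI grad)

variable {P : Params} {N : ℕ} [NeZero N]

section TowerDoor

omit [NeZero N] in
/-- ★ **FORWARD UNIT STEPS SEEN ON THE TORUS LIFT INTO `□₀`**, from the collar `□₀ + 1 ⊆ □̃` ([6] p. 98: the distance of `∂□̃` to `□₀` is at least one bond) and the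
non-wrapping of `□̃`: `x ∈ □₀`, `π x + e_μ ∈ π(□₀)` ⇒ `x + e_μ ∈ □₀`. [cite: Balaban1985RegularSpaces, p.98, (1.131) p.99; Balaban1987RG1, (0.1) p.251] -/
theorem add_e_mem_sq_zero_of_shift_mem_image_of_injOn_tcube {K' : ℕ} {Ω' : ℕ → Set (B7Prop1Explicit.Site P.d)} (c : CubeB8 P.d P.L K' Ω')
    (hinj : Set.InjOn (cover P) (tcube P.L c.a c.M c.ρ c.k)) {x : Pt P.d} (hx : x ∈ c.sq 0) {μ : Fin P.d}
    (h : (cover P x).shift μ ∈ cover P '' c.sq 0) : x + e μ ∈ c.sq 0 := by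
  have hL : 2 ≤ P.L := P.hL.2
  have hρ1 : 1 ≤ c.ρ := le_trans (le_trans (by norm_num) hL) c.L_le_ρ
  have h0 : c.sq 0 = cube P.L c.a c.M c.ρ c.k 0 := B8Eq131CubesAdmissible.cubeFam_false_zero P.L c.a c.M c.ρ c.k
  obtain ⟨x', hx', hc⟩ := h
  rw [← cover_add_e] at hc
  have h1 : x + e μ ∈ tcube P.L c.a c.M c.ρ c.k := by
    have hcol := B8Eq131Cubes.collar_cube (a := c.a) (M := c.M) hL hρ1 (Nat.zero_le c.k)
    have hxc : x ∈ cube P.L c.a c.M c.ρ c.k 0 := h0 ▸ hx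
    exact hcol x hxc (x + e μ) fun i => by
      rw [Pi.add_apply, e_apply]
      split_ifs <;> constructor <;> linarith
  have h2 : x' ∈ tcube P.L c.a c.M c.ρ c.k := by
    have hxc : x' ∈ cube P.L c.a c.M c.ρ c.k 0 := h0 ▸ hx'
    exact B8Eq131Cubes.cube_subset_tcube hL hρ1 (Nat.zero_le c.k) hxc
  rw [← hinj h2 h1 hc]
  exact hx'

omit [NeZero N] in
/-- `□_j ⊆ □₀` for `j ≤ k` (the (1.131) tower is decreasing). [cite: Balaban1985RegularSpaces, (1.131) p.99] -/
theorem sq_subset_sq_zero {K' : ℕ} {Ω' : ℕ → Set (B7Prop1Explicit.Site P.d)} (c : CubeB8 P.d P.L K' Ω') {j : ℕ} (hj : j ≤ c.k) : c.sq j ⊆ c.sq 0 := by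
  rcases Nat.eq_zero_or_pos j with h0 | hpos
  · subst h0; exact subset_rfl
  · have h1 : c.sq j = cube P.L c.a c.M c.ρ c.k j := B8Eq131CubesAdmissible.cubeFam_of_pos false P.L c.a c.M c.ρ hpos hj
    have h2 : c.sq 0 = cube P.L c.a c.M c.ρ c.k 0 := B8Eq131CubesAdmissible.cubeFam_false_zero P.L c.a c.M c.ρ c.k
    rw [h1, h2]
    exact B8Eq131Cubes.cube_anti (Nat.zero_le j) hj

/-- ★★★ **THE (152)+(153) DOOR ON THE WHOLE TOWER `□₀`** — FILE 3d′'s `exists_localGauge152_tower_window_of_gaugedBoundB8` at `X := □₀`, `X_t := □`, `X′ := □̃`.  Hypotheses: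
`d ≥ 2`; a `CubeB8` datum `c` with `c.k = n`; `0 ≤ r`; `GaugedBoundB8 L η_n (zdLift N U) c r` (the HYPOTHESIS); the non-wrapping `Set.InjOn π □̃`; the per-bond window
`4·(N·r) < 2π`.  Conclusions — ONE `u`, ONE `A`: (1) `U^u = e^{iη_nA}` on the bonds of `regionOfSet (π(□₀))`; (2) `∀ j ≤ k`, `‖A ⟨π x, μ⟩‖ ≤ 2·(r·(Lʲη_n)⁻¹)` for `x, x + e_μ ∈ □_j`
([15] (152) «on Ω′_j»); (3)–(6) the four top-box letters `≤ 2r` on `π(□)` (as every earlier door); (7) `∃ A′`, `A ⟨π x, μ⟩ = A′ x μ` on `□̃` ∧ `IsLandau138 L k η_n □₀ Λ′ 1 A′`.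
[cite: Balaban1985Variational, (144)–(153) pp.300–301; Balaban1985RegularSpaces, Prop. 6 (1.135)–(1.138) p.99, (1.131) p.99, p.98, (1.38) p.82; Balaban1987RG1, (0.1) p.251] -/
theorem exists_localGauge152_tower_of_gaugedBoundB8 (hd : 2 ≤ P.d) {K' : ℕ} {Ω' : ℕ → Set (B7Prop1Explicit.Site P.d)} (c : CubeB8 P.d P.L K' Ω')
    (U : GaugeField P 0 (SU N)) {n : ℕ} (hk : c.k = n) {r : ℝ} (hr : 0 ≤ r)
    (hG : letI : CStarAlgebra (MatA N) := {}; GaugedBoundB8 P.L (P.eta n) (zdLift N U) c r)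
    (hinj : Set.InjOn (cover P) (tcube P.L c.a c.M c.ρ c.k)) (h4 : 4 * ((N : ℝ) * r) < 2 * Real.pi) :
    ∃ u : GaugeTransf P 0 (SU N), ∃ A : PBond P 0 → MatA N,
      (∀ b ∈ (Sect2.regionOfSet P (cover P '' c.sq 0)).bonds, gaugeU (fun x => ιSU N (u x)) (fun b' => ιSU N (U b')) b = expI (P.eta n) (A b)) ∧
      (∀ j, j ≤ c.k → ∀ (x : Pt P.d) (μ : Fin P.d), x ∈ c.sq j → x + e μ ∈ c.sq j → ‖A ⟨cover P x, μ⟩‖ ≤ 2 * (r * ((P.L : ℝ) ^ j * P.eta n)⁻¹)) ∧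
      (∀ b ∈ (Sect2.regionOfSet P (cover P '' box P.L c.a c.M c.k)).bonds, ‖A b‖ ≤ 2 * r) ∧
      (∀ q ∈ (Sect2.regionOfSet P (cover P '' box P.L c.a c.M c.k)).dpairs, ‖grad (P.eta n) q.2.1 (fun y => A ⟨y, q.2.2⟩) q.1‖ ≤ 2 * r) ∧
      (∀ b ∈ Sect2.bondsDeep (cover P '' box P.L c.a c.M c.k), ‖Sect2.codiffCurlA (P.eta n) A b.src b.dir‖ ≤ 2 * r) ∧
      (∀ b ∈ Sect2.bondsDeep (cover P '' box P.L c.a c.M c.k),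
          ‖∑ ν : Fin P.d, ((P.eta n : ℝ) : ℂ)⁻¹ •
              (grad (P.eta n) ν (fun y => A ⟨y, b.dir⟩) (b.src.unshift ν) - grad (P.eta n) ν (fun y => A ⟨y, b.dir⟩) b.src)‖ ≤ 2 * r) ∧
      ∃ A' : B7Prop1Explicit.Site P.d → Fin P.d → MatA N,
        (∀ x, x ∈ tcube P.L c.a c.M c.ρ c.k → ∀ μ, A ⟨cover P x, μ⟩ = A' x μ) ∧
        IsLandau138 P.L c.k (P.eta n) (c.sq 0) c.lamS (1 : B7Prop1Explicit.Site P.d → Fin P.d → (MatA N)ˣ) A' := by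
  have hL : 2 ≤ P.L := P.hL.2
  have hρ1 : 1 ≤ c.ρ := le_trans (le_trans (by norm_num) hL) c.L_le_ρ
  have h0 : c.sq 0 = cube P.L c.a c.M c.ρ c.k 0 := B8Eq131CubesAdmissible.cubeFam_false_zero P.L c.a c.M c.ρ c.k
  have hsqT : c.sq 0 ⊆ tcube P.L c.a c.M c.ρ c.k := by
    rw [h0]; exact B8Eq131Cubes.cube_subset_tcube hL hρ1 (Nat.zero_le _)
  have hinj0 : Set.InjOn (cover P) (c.sq 0) := hinj.mono hsqT
  obtain ⟨u, A, h1, h2, h3, h4', h5, h6, h7⟩ :=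
    exists_localGauge152_tower_window_of_gaugedBoundB8 hd c U hk hr hG hsqT (box_subset_sq_zero c) hinj
      (fun _ hx _ h => add_e_mem_sq_zero_of_shift_mem_image_of_injOn_tcube c hinj hx h)
      (fun _ hx _ h => add_e_mem_box_of_shift_mem_image_of_injOn c hinj0 hx h)
      (fun _ hx _ h => sub_e_mem_box_of_unshift_mem_image_of_injOn c hinj0 hx h) subset_rfl subset_rfl h4
  exact ⟨u, A, h1, fun j hj x μ hx hx' => h2 j hj x μ (sq_subset_sq_zero c hj hx) (sq_subset_sq_zero c hj hx') hx hx', h3, h4', h5, h6, h7⟩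

end TowerDoor

end Literature.MathematicalPhysics.QuantumFieldTheory.Balaban1983to89.Node00

end
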